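import Summits.QuantumFields.YangMills.Theorems.LuscherReductionTwistedTraceScalingBOCoreDefectPointwise
import Summits.QuantumFields.YangMills.Theorems.LuscherReductionTwistedTraceScalingBODefectOutSchur
import HarnessLib

/-!
# (C4-CORE γ, the one new estimate) THE AMPLITUDE OF THE DUAL BO FUNCTION IS AT MOST TWICE THE CENTRAL TRANSFER AT THE ORIGIN
# (lane A of S-BASE, crux `TwistedTraceScaling` stmt-QuantumFields-20203, C4-CORE, the (OD) pen; `pub/ym-fleet/ym-luscher-20007-p1/HANDOFF-g20.md` (γ))

The dual BO function of `…BODefectCoreCurrency.core_defect_currency` has amplitude `a₀ = c₁(β)·S/D` (`S` the stiff Gaussian top, `D` the slow-window mass) with `c₁`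
only known to exist; its QUASIMODE FLOOR conjunct says `|T(v') − a₀e^{−E(x̂')}| ≤ η·a₀e^{−E(x̂')}` on the inner tube (`η = β^{-1/5}`).  At `v' = 0` (`E(0) = 0`) this gives
★ `amplitude_le_of_floor`: `a₀ ≤ 2·T(0)` once `η ≤ 1/2`, and ★ `abs_fpFibreTransfer_le_expCard`: `|T| ≤ C_W·e^{2β|E|}·C_Ω·|π⊗dg|` explicitly — so `a₀ ≤ 2C_W C_Ω|π⊗dg|·e^{2β|E|}`,
the polynomial-times-`e^{2β|E|}` control the shell piece `…BODefectShellB.shell_dualBO_sq_integral_le` needs against the currency floor `…BOCurrencyFloorZ.currency_floor_inv`.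
HONEST FRAMING: bookkeeping for a stub of a child of the CONDITIONAL route R2b1; the hOD assembly, (B-ST), C4-CORE remain OPEN; not a gap, not Clay.
-/

set_option autoImplicit false

noncomputable section

open MeasureTheory Filter Topology Real
open scoped BigOperators
open Literature.MathematicalPhysics.QuantumFieldTheory
open Literature.MathematicalPhysics.QuantumLattice

namespace Summit.QuantumFields.YangMills.Theorems.FemtoTransferGap.TwoLattice.ConstTube

open Summit.QuantumFields.YangMills.Theorems.FemtoTransferGap
open Summit.QuantumFields.YangMills.Theorems.FemtoTransferGap.TwoLattice
open Summit.QuantumFields.YangMills.Theorems.FemtoTransferGap.TwoLattice.Avg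
open Summit.QuantumFields.YangMills.Theorems.FemtoTransferGap.TwoLattice.Stiff (LinkSpace)

variable {L : ℕ} [NeZero L]

/-- ★ `|fpFibreTransfer β Ω W U u| ≤ C_W·(e^{2β})^{|E|}·C_Ω·(π⊗dg)(univ)` for `β ≥ 0` — the explicit form of `abs_fpFibreTransfer_le'`. [folklore] -/
theorem abs_fpFibreTransfer_le_expCard {β : ℝ} (hβ : 0 ≤ β) {Ω : LinkSpace L → ℝ} {CΩ : ℝ} (hCΩ : ∀ x, |Ω x| ≤ CΩ) {W : (Site 3 L → SU2) → ℝ} {CW : ℝ}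
    (hCW : ∀ g, |W g| ≤ CW) (U : GaugeConfig 3 L SU2) (u : GaugeConfig 3 1 SU2) :
    |fpFibreTransfer L β Ω W U u| ≤ CW * Real.exp (2 * β) ^ Fintype.card (Edge 3 L) * CΩ * ((orthoTransverse L).prod (gaugeMeasure L)).real Set.univ := by
  haveI := isFiniteMeasure_orthoTransverse L
  set M : ℝ := Real.exp (2 * β) ^ Fintype.card (Edge 3 L) with hMdef
  have hM : ∀ U' V' : GaugeConfig 3 L SU2, transferKernel su2Rep β U' V' ≤ M := fun U' V' => (le_abs_self _).trans (abs_transferKernel_le_lat hβ (U', V'))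
  have hCW0 : 0 ≤ CW := (abs_nonneg _).trans (hCW 1)
  have hM0 : 0 ≤ M := by positivity
  have hb : ∀ p : (Edge 3 L → Fin 3 → ℝ) × (Site 3 L → SU2), |W p.2 * transferKernel su2Rep β U (gaugeTransform p.2 (orthoTube L u p.1)) * Ω (linkEmbed L p.1)| ≤ CW * M * CΩ :=
    fun p => by
      rw [abs_mul, abs_mul, abs_of_pos (transferKernel_pos su2Rep β _ _)]
      exact mul_le_mul (mul_le_mul (hCW _) (hM _ _) (transferKernel_pos su2Rep β _ _).le hCW0) (hCΩ _) (abs_nonneg _) (mul_nonneg hCW0 hM0)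
  unfold fpFibreTransfer
  calc |∫ p, W p.2 * transferKernel su2Rep β U (gaugeTransform p.2 (orthoTube L u p.1)) * Ω (linkEmbed L p.1) ∂(orthoTransverse L).prod (gaugeMeasure L)|
      ≤ ∫ p, |W p.2 * transferKernel su2Rep β U (gaugeTransform p.2 (orthoTube L u p.1)) * Ω (linkEmbed L p.1)| ∂(orthoTransverse L).prod (gaugeMeasure L) :=
        abs_integral_le_integral_abs
    _ ≤ ∫ _p, CW * M * CΩ ∂(orthoTransverse L).prod (gaugeMeasure L) :=
        integral_mono_of_nonneg (ae_of_all _ fun _ => abs_nonneg _) (integrable_const _) (ae_of_all _ hb)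
    _ = CW * M * CΩ * ((orthoTransverse L).prod (gaugeMeasure L)).real Set.univ := by rw [integral_const, smul_eq_mul, Measure.real]; ring

omit [NeZero L] in
/-- `|T − a| ≤ η·a`, `η ≤ 1/2`, `a ≥ 0` ⇒ `a ≤ 2T`. [folklore] -/
theorem le_two_mul_of_abs_sub_le {T a η : ℝ} (h : |T - a| ≤ η * a) (hη : η ≤ 1 / 2) (ha : 0 ≤ a) : a ≤ 2 * T := by
  have h1 := (abs_le.mp h).1
  nlinarith

/-- ★ **THE AMPLITUDE FROM THE QUASIMODE FLOOR AT THE ORIGIN**: if on the inner tube `|T(v') − c·(S·e^{−E(x̂')})/D| ≤ η·(c·(S·e^{−E(x̂')})/D)` (the floor conjunct of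
`…BODefectCoreCurrency.core_defect_currency`, `T(v') = fpFibreTransfer β Ω W (orthoTube 1 v') 1`), `E(0) = 0`, `η ≤ 1/2`, `c·S/D ≥ 0`, `|Ω| ≤ C_Ω`, `|W| ≤ C_W`, `β ≥ 0`, then
`c·S/D ≤ 2·C_W·(e^{2β})^{|E|}·C_Ω·(π⊗dg)(univ)`. [cite: Luscher1983, §3] -/
theorem amplitude_le_of_floor {β : ℝ} (hβ : 0 ≤ β) {Ω : LinkSpace L → ℝ} {CΩ : ℝ} (hCΩ : ∀ x, |Ω x| ≤ CΩ) {W : (Site 3 L → SU2) → ℝ} {CW : ℝ}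
    (hCW : ∀ g, |W g| ≤ CW) {E : LinkSpace L → ℝ} (hE0 : E 0 = 0) {c S D η ρT r : ℝ} (ha : 0 ≤ c * S / D) (hη : η ≤ 1 / 2) (hρT : 0 ≤ ρT) (hr : 0 ≤ r)
    (hfloor : ∀ v' : Edge 3 L → Fin 3 → ℝ, v' ∈ capBalancedSet L → (∀ (e : Edge 3 L) (k : Fin 3), |v' e k| ≤ ρT) → ‖linkEmbed L v'‖ ≤ r →
      |fpFibreTransfer L β Ω W (orthoTube L 1 v') 1 - c * ((S * Real.exp (-E (linkEmbed L v'))) / D)| ≤ η * (c * ((S * Real.exp (-E (linkEmbed L v'))) / D))) :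
    c * S / D ≤ 2 * (CW * Real.exp (2 * β) ^ Fintype.card (Edge 3 L) * CΩ * ((orthoTransverse L).prod (gaugeMeasure L)).real Set.univ) := by
  have h0 := hfloor 0 (zero_mem_capBalancedSet (L := L)) (fun e k => by simpa using hρT) (by rw [map_zero, norm_zero]; exact hr)
  rw [map_zero, hE0, neg_zero, Real.exp_zero, mul_one] at h0
  have e1 : c * (S / D) = c * S / D := by ring
  rw [e1] at h0
  have h1 := le_two_mul_of_abs_sub_le h0 hη ha
  have h2 := (le_abs_self _).trans (abs_fpFibreTransfer_le_expCard (L := L) hβ hCΩ hCW (orthoTube L 1 (0 : Edge 3 L → Fin 3 → ℝ)) 1)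
  linarith

end Summit.QuantumFields.YangMills.Theorems.FemtoTransferGap.TwoLattice.ConstTube

end
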